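import Summits.CriticalPhenomena.PercolationContinuityZ3.Theorems.PercNearOneGluingAdditiveGluingKnLemma4Pair
import HarnessLib

/-!
# Crux `PercNearOneGluing.AdditiveGluing` (stmt-CriticalPhenomena-4576), line `tieline`: the mixture Lemma 4 (ML4) from the
# ONE-WEIGHT mixture inequality ML5

Support file (`--supports stmt-CriticalPhenomena-4576`, lead c9).  No definitions, no named facts, no sorries.

Weighted graph on `Fin n` (`μ = prodBernoulli w`), target `b`, pair `{a₁, a₂}` to be glued, spectator `c`, observer `o`;
`N = {c ↮ a₁} ∩ {c ↮ a₂}`, `O_A = {o ↔ a₁} ∪ {o ↔ a₂}`, gains `G_x = μ({x ↮ b} ∩ ({x ↔ a₁} ∪ {x ↔ a₂}) ∩ ({a₁ ↔ b} ∪ {a₂ ↔ b}))`,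
`G_max = μ(a₁↔b ∪ a₂↔b) − min_j μ(a_j ↔ b)`.

* **ML5** (registered stub `stub_ml5_c9` of skeleton v18; lead c8's numerically-true ML5):
  `μ(N)·G_o ≤ μ(N ∩ O_A)·G_max + μ(N ∩ O_Aᶜ)·G_c`, i.e. `G_o ≤ Φ·G_max + (1−Φ)·G_c` with the single weight `Φ = μ(o ↔ A | c ↮ A)`.
* **ML4** (`stub_mixtureLemma4_c8`): `(ψ_A + ψ_c)·G_o ≤ ψ_A·G_max + ψ_c·G_c`, `ψ_A = μ(N ∩ O_A)`, `ψ_c = μ(N ∩ o↔c)`.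

`ML5 ⟹ ML4` (`mixtureLemma4_of_ml5`): write `μ(N)·G_o = ψ_A·G_o + μ(N ∩ O_Aᶜ)·G_o`; if `G_c ≤ G_o` use `ψ_c ≤ μ(N ∩ O_Aᶜ)` (under
`c ↮ A`, `o ↔ c` forces `o ↮ A`), otherwise Kozma–Nitzan's Lemma 4 `G_o ≤ G_max` (`knLemma4_pair`).
[cite: KozmaNitzan2024, Lemma 4 / eq. (8)–(9) (pp. 9–10), Theorem 1 / (6) (pp. 7–8)]
-/

namespace Summit.CriticalPhenomena.PercolationContinuityZ3.Theorems

open MeasureTheory Set Literature.Probability.LatticeModels Literature.Probability.Percolation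

noncomputable section
open Classical

namespace ML5

variable {n : ℕ}

/-- Under `c ↮ a₁, c ↮ a₂`, the event `o ↔ c` is contained in `(o ↔ a₁ ∪ o ↔ a₂)ᶜ`. [folklore] -/
theorem N_inter_Oc_subset (o a₁ a₂ c : Fin n) :
    ((openConn c a₁)ᶜ ∩ (openConn c a₂)ᶜ ∩ openConn o c : Set (BondConfig (Fin n))) ⊆
      (openConn c a₁)ᶜ ∩ (openConn c a₂)ᶜ ∩ (openConn o a₁ ∪ openConn o a₂)ᶜ := by
  rintro ω ⟨⟨h1, h2⟩, hoc⟩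
  simp only [mem_inter_iff, mem_compl_iff, mem_union, openConn, mem_setOf_eq] at h1 h2 hoc ⊢
  exact ⟨⟨h1, h2⟩, fun h => h.elim (fun ho1 => h1 (hoc.symm.trans ho1)) (fun ho2 => h2 (hoc.symm.trans ho2))⟩

/-- `μ(N) = μ(N ∩ O_A) + μ(N ∩ O_Aᶜ)`. [folklore] -/
theorem real_N_split (w : Sym2 (Fin n) → unitInterval) (o a₁ a₂ c : Fin n) :
    (prodBernoulli w).real ((openConn c a₁)ᶜ ∩ (openConn c a₂)ᶜ : Set (BondConfig (Fin n))) =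
      (prodBernoulli w).real ((openConn c a₁)ᶜ ∩ (openConn c a₂)ᶜ ∩ (openConn o a₁ ∪ openConn o a₂)) +
        (prodBernoulli w).real ((openConn c a₁)ᶜ ∩ (openConn c a₂)ᶜ ∩ (openConn o a₁ ∪ openConn o a₂)ᶜ) := by
  have hm : MeasurableSet (openConn o a₁ ∪ openConn o a₂ : Set (BondConfig (Fin n))) := MeasurableSet.of_discrete
  rw [← measureReal_inter_add_sdiff (s := ((openConn c a₁)ᶜ ∩ (openConn c a₂)ᶜ : Set (BondConfig (Fin n)))) hm,
    Set.sdiff_eq]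

end ML5

/-- **ML4 from ML5** (skeleton glue, lead c9): the one-weight mixture inequality
`μ(N)·G_o ≤ μ(N ∩ O_A)·G_max + μ(N ∩ O_Aᶜ)·G_c` for every `(o, b, a₁, a₂, c)` implies the mixture Lemma 4
`(ψ_A + ψ_c)·G_o ≤ ψ_A·G_max + ψ_c·G_c` (`stub_mixtureLemma4_c8`).  Case `G_c ≤ G_o`: `ψ_c ≤ μ(N ∩ O_Aᶜ)`; case `G_o ≤ G_c`:
Kozma–Nitzan's Lemma 4 (`knLemma4_pair`). [cite: KozmaNitzan2024, Lemma 4 / eq. (8)–(9) (pp. 9–10)] -/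
theorem mixtureLemma4_of_ml5
    (h5 : ∀ (n : ℕ) (w : Sym2 (Fin n) → unitInterval) (o b a₁ a₂ c : Fin n),
      (prodBernoulli w).real ((openConn c a₁)ᶜ ∩ (openConn c a₂)ᶜ : Set (BondConfig (Fin n))) *
          (prodBernoulli w).real ((openConn o b)ᶜ ∩ (openConn o a₁ ∪ openConn o a₂) ∩ (openConn a₁ b ∪ openConn a₂ b)) ≤
        (prodBernoulli w).real ((openConn c a₁)ᶜ ∩ (openConn c a₂)ᶜ ∩ (openConn o a₁ ∪ openConn o a₂)) *
            ((prodBernoulli w).real (openConn a₁ b ∪ openConn a₂ b) -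
              min ((prodBernoulli w).real (openConn a₁ b)) ((prodBernoulli w).real (openConn a₂ b))) +
          (prodBernoulli w).real ((openConn c a₁)ᶜ ∩ (openConn c a₂)ᶜ ∩ (openConn o a₁ ∪ openConn o a₂)ᶜ) *
            (prodBernoulli w).real ((openConn c b)ᶜ ∩ (openConn c a₁ ∪ openConn c a₂) ∩ (openConn a₁ b ∪ openConn a₂ b))) :
    ∀ (n : ℕ) (w : Sym2 (Fin n) → unitInterval) (o b a₁ a₂ c : Fin n),
    ((prodBernoulli w).real ((openConn c a₁)ᶜ ∩ (openConn c a₂)ᶜ ∩ (openConn o a₁ ∪ openConn o a₂)) +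
          (prodBernoulli w).real ((openConn c a₁)ᶜ ∩ (openConn c a₂)ᶜ ∩ openConn o c)) *
        (prodBernoulli w).real ((openConn o b)ᶜ ∩ (openConn o a₁ ∪ openConn o a₂) ∩ (openConn a₁ b ∪ openConn a₂ b)) ≤
      (prodBernoulli w).real ((openConn c a₁)ᶜ ∩ (openConn c a₂)ᶜ ∩ (openConn o a₁ ∪ openConn o a₂)) *
          ((prodBernoulli w).real (openConn a₁ b ∪ openConn a₂ b) -
            min ((prodBernoulli w).real (openConn a₁ b)) ((prodBernoulli w).real (openConn a₂ b))) +
        (prodBernoulli w).real ((openConn c a₁)ᶜ ∩ (openConn c a₂)ᶜ ∩ openConn o c) *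
          (prodBernoulli w).real ((openConn c b)ᶜ ∩ (openConn c a₁ ∪ openConn c a₂) ∩ (openConn a₁ b ∪ openConn a₂ b)) := by
  intro n w o b a₁ a₂ c
  have h := h5 n w o b a₁ a₂ c
  have hL4 := knLemma4_pair w o a₁ a₂ b
  have hsplit := ML5.real_N_split w o a₁ a₂ c
  have hψc : (prodBernoulli w).real ((openConn c a₁)ᶜ ∩ (openConn c a₂)ᶜ ∩ openConn o c : Set (BondConfig (Fin n))) ≤
      (prodBernoulli w).real ((openConn c a₁)ᶜ ∩ (openConn c a₂)ᶜ ∩ (openConn o a₁ ∪ openConn o a₂)ᶜ : Set (BondConfig (Fin n))) :=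
    measureReal_mono (ML5.N_inter_Oc_subset o a₁ a₂ c)
  have hA : 0 ≤ (prodBernoulli w).real ((openConn c a₁)ᶜ ∩ (openConn c a₂)ᶜ ∩ (openConn o a₁ ∪ openConn o a₂) :
      Set (BondConfig (Fin n))) := measureReal_nonneg
  have hC : 0 ≤ (prodBernoulli w).real ((openConn c a₁)ᶜ ∩ (openConn c a₂)ᶜ ∩ openConn o c : Set (BondConfig (Fin n))) :=
    measureReal_nonneg
  have hG : 0 ≤ (prodBernoulli w).real ((openConn c a₁)ᶜ ∩ (openConn c a₂)ᶜ ∩ (openConn o a₁ ∪ openConn o a₂)ᶜ :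
      Set (BondConfig (Fin n))) := measureReal_nonneg
  rcases le_total
      ((prodBernoulli w).real ((openConn c b)ᶜ ∩ (openConn c a₁ ∪ openConn c a₂) ∩ (openConn a₁ b ∪ openConn a₂ b) :
        Set (BondConfig (Fin n))))
      ((prodBernoulli w).real ((openConn o b)ᶜ ∩ (openConn o a₁ ∪ openConn o a₂) ∩ (openConn a₁ b ∪ openConn a₂ b) :
        Set (BondConfig (Fin n)))) with hco | hoc
  · -- `G_c ≤ G_o`: the spectator term is the only possibly negative one and `ψ_c ≤ μ(N ∩ O_Aᶜ)`
    rw [hsplit] at h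
    nlinarith [mul_le_mul_of_nonneg_right hψc (sub_nonneg.2 hco), h, mul_nonneg hA (sub_nonneg.2 hL4)]
  · -- `G_o ≤ G_c`: both terms nonnegative by Lemma 4
    nlinarith [mul_nonneg hA (sub_nonneg.2 hL4), mul_nonneg hC (sub_nonneg.2 hoc)]

end

end Summit.CriticalPhenomena.PercolationContinuityZ3.Theorems
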